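import Literature.MathematicalPhysics.QuantumFieldTheory.BalabanImbrieJaffe1984to88.BIJ88ScaleSums
import Literature.MathematicalPhysics.QuantumFieldTheory.BalabanImbrieJaffe1984to88.BIJ88Sect4Statements

/-!
# `BalabanImbrieJaffe1984to88.BIJ88GaussFactor309` — T. Bałaban, J. Imbrie, A. Jaffe, *Effective action and cluster properties of
the abelian Higgs model*, Commun. Math. Phys. **114** (1988) 257–315 [BalabanImbrieJaffe1988]: p. 309 [PDF 53] (Sect. 5.14, proof
of (5.14.4)), the sentence *"After integration over A^{(k)}, we obtain factors ct^{−n}e^{−cp(te_k)²} ≤ (e^β(L^kε/ε₀)^{1/4−α})ⁿ."* —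
the printed INEQUALITY, PROVED on r18's carriers `eK` (2.2), `pLog` (2.33), `rLen` (2.3) [`BIJ88Sect2Statements`] and `eps0` /
`Continues` (p. 273) [`BIJ88Sect4Statements`], in the e_k-small regime and for every interpolation parameter 0 < t ≤ 1.  The Gaussian
integration that PRODUCES the left side is not modelled (it is the preceding clause of the sentence); companion of
`BIJ88ChiTDeriv309` (the t-derivative display four lines above, p251088).

statement-level skeleton of published theorems with citation tags; proofs where landed; nothing here is a claim about the Yang–Mills mass gap

MECHANISM (the paper's standing small-coupling bookkeeping, (2.3)/(2.33) p. 260/263).  p(te_k)² = |log(te_k)⁻¹|^{2p} = r-scale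
with exponent 2p > 1, so `BIJ88ScaleSums.exp_rLen_le_rpow` gives e^{−cp(te_k)²} ≤ (te_k)^{n+1} as soon as n + 1 ≤ c|log e_k⁻¹|^{2p−1}
(the condition at x = e_k implies it at every x = te_k ≤ e_k); then ct^{−n}(te_k)^{n+1} = c·t·e_k^{n+1} ≤ (c e_k)e_kⁿ ≤ e_kⁿ once
c e_k ≤ 1; finally e_k = (L^kε)^{(4−d)/2}e = (sε₀)^{(4−d)/2}e ≤ s^{(4−d)/2}e ≤ s^{1/4−α}e^β for s = L^kε/ε₀ ≤ 1, ε₀ ≤ 1, 0 < e ≤ 1,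
β ≤ 1 and 1/4 − α ≤ (4−d)/2 (d < 4, α ≥ 0) — «e^β» in the CHARGE reading (p. 270 *"β > 0 is a fixed small power"*; GAPS G-C2-p36-04,
`BIJ88W3Chain298`).

Contents (theorems only; no definitions, no `Prop` facts): `pLog_sq`, `log_inv_mono`, `exp_pLog_sq_le_pow`, `eK_le_one_of`,
`eK_le_vertex`, **`gauss309`** (parameters s, ε₀ with L^kε = sε₀), **`gauss309_continues`** (s = L^kε/ε₀ under the stopping rule
`Continues L ε ε₀ k`), `eps0_pos`, `eps0_le_one`, **`gauss309_eps0`** (ε₀ = `eps0 λ e β` of p. 273).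

## References
* [BalabanImbrieJaffe1988] T. Bałaban, J. Imbrie, A. Jaffe, Commun. Math. Phys. 114 (1988) 257–315, p. 309 (Sect. 5.14); (2.2)–(2.3)
  p. 260, (2.33) p. 263, (3.34) p. 270, (4.1) p. 273.
-/

namespace Literature.MathematicalPhysics.QuantumFieldTheory.BalabanImbrieJaffe1984to88.BIJ88GaussFactor309

open Literature.MathematicalPhysics.QuantumFieldTheory.BalabanImbrieJaffe1984to88.BIJ88Sect2Statements
open Literature.MathematicalPhysics.QuantumFieldTheory.BalabanImbrieJaffe1984to88.BIJ88ScaleSums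
open Literature.MathematicalPhysics.QuantumFieldTheory.BalabanImbrieJaffe1984to88.BIJ88Sect4Statements

/-! ## Scalar steps -/

/-- p(x)² is the r-scale with exponent 2p: (|log x⁻¹|^p)² = |log x⁻¹|^{2p}, i.e. `pLog p x ^ 2 = rLen (2p) x`.
[cite: BalabanImbrieJaffe1988, (2.33) p.263] -/
theorem pLog_sq (p x : ℝ) : pLog p x ^ 2 = rLen (2 * p) x := by
  unfold pLog rLen
  rw [← Real.rpow_natCast, ← Real.rpow_mul (abs_nonneg _)]
  push_cast
  ring_nf

/-- log x⁻¹ is antitone in x on (0, ∞): for 0 < x ≤ y, log y⁻¹ ≤ log x⁻¹. [cite: BalabanImbrieJaffe1988, (2.3) p.260] -/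
theorem log_inv_mono {x y : ℝ} (hx : 0 < x) (hxy : x ≤ y) : Real.log y⁻¹ ≤ Real.log x⁻¹ := by
  rw [Real.log_inv, Real.log_inv, neg_le_neg_iff]
  exact Real.log_le_log hx hxy

/-- The Gaussian small factor beats any power: for 0 < x ≤ e_k ≤ 1, 2p > 1, c ≥ 0 and n + 1 ≤ c|log e_k⁻¹|^{2p−1},
e^{−c p(x)²} ≤ x^{n+1}. [cite: BalabanImbrieJaffe1988, p.309 (Sect. 5.14)] -/
theorem exp_pLog_sq_le_pow {x ek c p : ℝ} {n : ℕ} (hx : 0 < x) (hxe : x ≤ ek) (hek1 : ek ≤ 1) (hp : 1 / 2 < p)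
    (hc : 0 ≤ c) (hreg : (n : ℝ) + 1 ≤ c * Real.log ek⁻¹ ^ (2 * p - 1)) :
    Real.exp (-(c * pLog p x ^ 2)) ≤ x ^ (n + 1) := by
  have hx1 : x ≤ 1 := hxe.trans hek1
  have hek : 0 < ek := hx.trans_le hxe
  have hR : 0 ≤ Real.log ek⁻¹ := Real.log_nonneg ((one_le_inv₀ hek).mpr hek1)
  have hmono : Real.log ek⁻¹ ^ (2 * p - 1) ≤ Real.log x⁻¹ ^ (2 * p - 1) :=
    Real.rpow_le_rpow hR (log_inv_mono hx hxe) (by linarith)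
  have hregx : ((n : ℝ) + 1) ≤ c * Real.log x⁻¹ ^ (2 * p - 1) :=
    hreg.trans (mul_le_mul_of_nonneg_left hmono hc)
  rw [pLog_sq, ← Real.rpow_natCast]
  push_cast
  exact exp_rLen_le_rpow hx hx1 (by linarith) hregx

/-- e_k ≤ 1 in the regime L^kε ≤ 1, 0 < e ≤ 1 (d < 4). [cite: BalabanImbrieJaffe1988, (2.2) p.260] -/
theorem eK_le_one_of {L ε e : ℝ} {d k : ℕ} (hLε0 : 0 ≤ L ^ k * ε) (hLε1 : L ^ k * ε ≤ 1) (he0 : 0 ≤ e) (he1 : e ≤ 1)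
    (hd : d < 4) : eK L ε e d k ≤ 1 := by
  unfold eK
  have hd' : (d : ℝ) < 4 := by exact_mod_cast hd
  have h1 : (L ^ k * ε) ^ ((4 - (d : ℝ)) / 2) ≤ 1 := Real.rpow_le_one hLε0 hLε1 (by linarith)
  calc (L ^ k * ε) ^ ((4 - (d : ℝ)) / 2) * e ≤ 1 * 1 :=
        mul_le_mul h1 he1 he0 zero_le_one
    _ = 1 := one_mul 1

/-- **The running charge is below the vertex factor** (charge reading): with L^kε = sε₀, 0 < s ≤ 1, 0 < ε₀ ≤ 1, 0 < e ≤ 1, β ≤ 1,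
d < 4 and 0 ≤ α, e_k = (sε₀)^{(4−d)/2}e ≤ s^{1/4−α}e^β. [cite: BalabanImbrieJaffe1988, p.309 (Sect. 5.14)] -/
theorem eK_le_vertex {L ε e s ε₀ α β : ℝ} {d k : ℕ} (hs0 : 0 < s) (hs1 : s ≤ 1) (hε₀0 : 0 < ε₀) (hε₀1 : ε₀ ≤ 1)
    (hLε : L ^ k * ε = s * ε₀) (he0 : 0 < e) (he1 : e ≤ 1) (hβ1 : β ≤ 1) (hd : d < 4) (hα : 0 ≤ α) :
    eK L ε e d k ≤ e ^ β * s ^ (1 / 4 - α) := by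
  unfold eK
  have hd' : (d : ℝ) < 4 := by exact_mod_cast hd
  have ha : 0 ≤ (4 - (d : ℝ)) / 2 := by linarith
  rw [hLε, Real.mul_rpow hs0.le hε₀0.le, mul_comm (e ^ β)]
  have h1 : ε₀ ^ ((4 - (d : ℝ)) / 2) ≤ 1 := Real.rpow_le_one hε₀0.le hε₀1 ha
  have h2 : s ^ ((4 - (d : ℝ)) / 2) ≤ s ^ (1 / 4 - α) := by
    apply Real.rpow_le_rpow_of_exponent_ge hs0 hs1
    have : (d : ℝ) ≤ 3 := by exact_mod_cast Nat.lt_succ_iff.mp hd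
    linarith
  have h3 : e ≤ e ^ β := by
    have := Real.rpow_le_rpow_of_exponent_ge he0 he1 hβ1
    rwa [Real.rpow_one] at this
  calc s ^ ((4 - (d : ℝ)) / 2) * ε₀ ^ ((4 - (d : ℝ)) / 2) * e ≤ s ^ (1 / 4 - α) * 1 * e ^ β :=
        mul_le_mul (mul_le_mul h2 h1 (by positivity) (by positivity)) h3 he0.le (by positivity)
    _ = s ^ (1 / 4 - α) * e ^ β := by ring

/-! ## The printed inequality -/

/-- **p. 309, «ct^{−n}e^{−cp(te_k)²} ≤ (e^β(L^kε/ε₀)^{1/4−α})ⁿ»** — with e_k = `eK L ε e d k` (2.2), p(·) = `pLog p` (2.33), the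
scale ratio s (L^kε = sε₀, 0 < s ≤ 1, 0 < ε₀ ≤ 1), an interpolation parameter 0 < t ≤ 1, a prefactor c′ ≥ 0 and a rate c ≥ 0,
p > ½, d < 4, 0 ≤ α, 0 < e ≤ 1, β ≤ 1, in the e_k-small regime n + 1 ≤ c|log e_k⁻¹|^{2p−1} and c′e_k ≤ 1:
c′ t^{−n} e^{−c p(te_k)²} ≤ (e^β s^{1/4−α})ⁿ.  [cite: BalabanImbrieJaffe1988, p.309 (Sect. 5.14)] -/
theorem gauss309 {L ε e s ε₀ t c c' p α β : ℝ} {d n k : ℕ} (hL : 0 < L) (hε : 0 < ε) (he0 : 0 < e) (he1 : e ≤ 1)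
    (hβ1 : β ≤ 1) (hα : 0 ≤ α) (hd : d < 4) (hs0 : 0 < s) (hs1 : s ≤ 1) (hε₀0 : 0 < ε₀) (hε₀1 : ε₀ ≤ 1)
    (hLε : L ^ k * ε = s * ε₀) (ht0 : 0 < t) (ht1 : t ≤ 1) (hp : 1 / 2 < p) (hc : 0 ≤ c) (hc' : 0 ≤ c')
    (hreg : (n : ℝ) + 1 ≤ c * Real.log (eK L ε e d k)⁻¹ ^ (2 * p - 1)) (hsmall : c' * eK L ε e d k ≤ 1) :
    c' / t ^ n * Real.exp (-(c * pLog p (t * eK L ε e d k) ^ 2)) ≤ (e ^ β * s ^ (1 / 4 - α)) ^ n := by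
  set ek := eK L ε e d k with hek_def
  have hek : 0 < ek := eK_pos hL hε he0 k
  have hLε1 : L ^ k * ε ≤ 1 := by
    rw [hLε]
    calc s * ε₀ ≤ 1 * 1 := mul_le_mul hs1 hε₀1 hε₀0.le zero_le_one
      _ = 1 := one_mul 1
  have hek1 : ek ≤ 1 := eK_le_one_of (by positivity) hLε1 he0.le he1 hd
  have hx : 0 < t * ek := mul_pos ht0 hek
  have hxe : t * ek ≤ ek := by nlinarith
  -- step 1: the Gaussian factor beats the power (te_k)^{n+1}
  have h1 : Real.exp (-(c * pLog p (t * ek) ^ 2)) ≤ (t * ek) ^ (n + 1) :=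
    exp_pLog_sq_le_pow hx hxe hek1 hp hc hreg
  -- step 2: c′ t^{−n} (t e_k)^{n+1} = c′ t e_k^{n+1} ≤ e_kⁿ
  have htn : 0 < t ^ n := pow_pos ht0 n
  have h2 : c' / t ^ n * (t * ek) ^ (n + 1) ≤ ek ^ n := by
    rw [mul_pow, pow_succ, pow_succ, div_mul_eq_mul_div]
    rw [show c' * (t ^ n * t * (ek ^ n * ek)) / t ^ n = (c' * ek) * t * ek ^ n by
      field_simp]
    calc c' * ek * t * ek ^ n ≤ 1 * 1 * ek ^ n := by
          apply mul_le_mul_of_nonneg_right _ (pow_nonneg hek.le n)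
          exact mul_le_mul hsmall ht1 ht0.le zero_le_one
      _ = ek ^ n := by ring
  -- step 3: e_k ≤ e^β s^{1/4−α}
  have h3 : ek ^ n ≤ (e ^ β * s ^ (1 / 4 - α)) ^ n :=
    pow_le_pow_left₀ hek.le (eK_le_vertex hs0 hs1 hε₀0 hε₀1 hLε he0 he1 hβ1 hd hα) n
  calc c' / t ^ n * Real.exp (-(c * pLog p (t * ek) ^ 2)) ≤ c' / t ^ n * (t * ek) ^ (n + 1) :=
        mul_le_mul_of_nonneg_left h1 (div_nonneg hc' htn.le)
    _ ≤ ek ^ n := h2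
    _ ≤ (e ^ β * s ^ (1 / 4 - α)) ^ n := h3

/-- **p. 309 under the stopping rule of p. 273.**  With s = L^kε/ε₀ and `Continues L ε ε₀ k` (L^kε < ε₀ ≤ 1):
c′ t^{−n} e^{−c p(te_k)²} ≤ (e^β (L^kε/ε₀)^{1/4−α})ⁿ, hypotheses as in `gauss309`. [cite: BalabanImbrieJaffe1988, p.309 (Sect. 5.14)] -/
theorem gauss309_continues {L ε e ε₀ t c c' p α β : ℝ} {d n k : ℕ} (hL : 0 < L) (hε : 0 < ε) (he0 : 0 < e)
    (he1 : e ≤ 1) (hβ1 : β ≤ 1) (hα : 0 ≤ α) (hd : d < 4) (hcont : Continues L ε ε₀ k) (hε₀1 : ε₀ ≤ 1)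
    (ht0 : 0 < t) (ht1 : t ≤ 1) (hp : 1 / 2 < p) (hc : 0 ≤ c) (hc' : 0 ≤ c')
    (hreg : (n : ℝ) + 1 ≤ c * Real.log (eK L ε e d k)⁻¹ ^ (2 * p - 1)) (hsmall : c' * eK L ε e d k ≤ 1) :
    c' / t ^ n * Real.exp (-(c * pLog p (t * eK L ε e d k) ^ 2)) ≤
      (e ^ β * (L ^ k * ε / ε₀) ^ (1 / 4 - α)) ^ n := by
  unfold Continues at hcont
  have hLε : 0 < L ^ k * ε := by positivity
  have hε₀0 : 0 < ε₀ := hLε.trans hcont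
  have hs0 : 0 < L ^ k * ε / ε₀ := div_pos hLε hε₀0
  have hs1 : L ^ k * ε / ε₀ ≤ 1 := by rw [div_le_one hε₀0]; exact hcont.le
  have hLε' : L ^ k * ε = L ^ k * ε / ε₀ * ε₀ := by field_simp
  exact gauss309 hL hε he0 he1 hβ1 hα hd hs0 hs1 hε₀0 hε₀1 hLε' ht0 ht1 hp hc hc' hreg hsmall

/-! ## With the printed ε₀ of p. 273 -/

/-- ε₀ = min{1, (8λ/e²)^{1/2}} e^β is positive for λ > 0, e > 0. [cite: BalabanImbrieJaffe1988, (4.1) p.273] -/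
theorem eps0_pos {lam e β : ℝ} (hlam : 0 < lam) (he : 0 < e) : 0 < eps0 lam e β := by
  unfold eps0
  apply mul_pos _ (Real.rpow_pos_of_pos he β)
  apply lt_min zero_lt_one
  exact Real.sqrt_pos.mpr (by positivity)

/-- ε₀ = min{1, (8λ/e²)^{1/2}} e^β ≤ 1 for 0 < e ≤ 1, β ≥ 0 (charge reading: e^β ≤ 1). [cite: BalabanImbrieJaffe1988, (4.1) p.273] -/
theorem eps0_le_one {lam e β : ℝ} (he0 : 0 < e) (he1 : e ≤ 1) (hβ : 0 ≤ β) : eps0 lam e β ≤ 1 := by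
  unfold eps0
  have h1 : min 1 (Real.sqrt (8 * lam / e ^ 2)) ≤ 1 := min_le_left _ _
  have h2 : e ^ β ≤ 1 := Real.rpow_le_one he0.le he1 hβ
  have h3 : 0 ≤ min 1 (Real.sqrt (8 * lam / e ^ 2)) := le_min zero_le_one (Real.sqrt_nonneg _)
  calc min 1 (Real.sqrt (8 * lam / e ^ 2)) * e ^ β ≤ 1 * 1 := mul_le_mul h1 h2 (by positivity) zero_le_one
    _ = 1 := one_mul 1

/-- **p. 309 with the printed ε₀ (4.1) p. 273** and the stopping rule L^kε < ε₀ (which forces ε₀ > 0): for 0 < e ≤ 1, 0 ≤ β ≤ 1, the factor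
inequality c′ t^{−n} e^{−c p(te_k)²} ≤ (e^β (L^kε/ε₀)^{1/4−α})ⁿ holds in the e_k-small regime of `gauss309`.
[cite: BalabanImbrieJaffe1988, p.309 (Sect. 5.14)] -/
theorem gauss309_eps0 {L ε e lam t c c' p α β : ℝ} {d n k : ℕ} (hL : 0 < L) (hε : 0 < ε) (he0 : 0 < e)
    (he1 : e ≤ 1) (hβ0 : 0 ≤ β) (hβ1 : β ≤ 1) (hα : 0 ≤ α) (hd : d < 4)
    (hcont : Continues L ε (eps0 lam e β) k) (ht0 : 0 < t) (ht1 : t ≤ 1) (hp : 1 / 2 < p) (hc : 0 ≤ c)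
    (hc' : 0 ≤ c') (hreg : (n : ℝ) + 1 ≤ c * Real.log (eK L ε e d k)⁻¹ ^ (2 * p - 1))
    (hsmall : c' * eK L ε e d k ≤ 1) :
    c' / t ^ n * Real.exp (-(c * pLog p (t * eK L ε e d k) ^ 2)) ≤
      (e ^ β * (L ^ k * ε / eps0 lam e β) ^ (1 / 4 - α)) ^ n :=
  gauss309_continues hL hε he0 he1 hβ1 hα hd hcont (eps0_le_one he0 he1 hβ0) ht0 ht1 hp hc hc' hreg hsmall

end Literature.MathematicalPhysics.QuantumFieldTheory.BalabanImbrieJaffe1984to88.BIJ88GaussFactor309
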